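import Mathlib
import HarnessLib
import Summits.CriticalPhenomena.PercolationContinuityZ3.Theses.PercLowPointHalfSpace
import Summits.CriticalPhenomena.PercolationContinuityZ3.Theorems.PercLowPointHalfSpaceLowPointIdentity
import Summits.CriticalPhenomena.PercolationContinuityZ3.Theorems.PercLowPointHalfSpaceCrossBushBookkeepingTransport
import Summits.CriticalPhenomena.PercolationContinuityZ3.Theorems.BoundaryTwoArmDecay.Negative.SecondArm
import Literature.Probability.Percolation.HalfSpacePinnedPairs
import Literature.Probability.Percolation.BondPercolationSymmetry

/-!
# Crux `PercLowPointHalfSpace.BoundaryTwoArmDecay` (stmt-CriticalPhenomena-0911), line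
# `staircase-bootstrap-floor-decoupling` — stub `stub_census`, part 0: the objects of the level census

Helper file for the registered stub `stub_census` (the TRUNCATED LEVEL CENSUS
`P(A_n ∧ K_n ≤ k) ≤ C·k·e_n`) of the skeleton
`Cruxes/BoundaryTwoArmDecay/Lines/staircase_bootstrap_floor_decoupling.lean`; lands with
`--supports stmt-CriticalPhenomena-0911` (registered sub-goal `stub_census_floorMTP`, the floor mass-transport
principle). It DEFINES the objects of the census (all later files of the stub are definition-free) and proves
their elementary properties:

* relative to a region `R` (the half-space `ℍ = halfSpace 3 = {0 ≤ x₀}` or the lowered half-space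
  `ℍ₋₁ = Hm = {-1 ≤ x₀}`) and a root `a`: the cluster `cl R a ω = C_R(a) = {u | a ↔ u in R}`, its slice
  sizes `fl R l a ω = |C_R(a) ∩ {x₀ = l}| ∈ ℕ∞`, the tallness event `tall R n a = {C_R(a) meets level n}`;
* the partner-kiss edges `PK n a ω` of `C_ℍ(a)` (for `a = 0` verbatim the set of the stub), the
  sub-cluster functional `J n a ω = Σ_{γ ∈ C_{ℍ₋₁}(a) ∩ ∂ℍ, C_ℍ(γ) n-tall} 1/|C_ℍ(γ) ∩ ∂ℍ|` (the number of
  `n`-tall `ℍ`-clusters inside `C_{ℍ₋₁}(a)`), the two transport functions `fTA` (two-anchor) and `fRT`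
  (root transport) of the two mass transports on the floor lattice, the selector `sel` of a least kiss
  edge (w.r.t. a fixed enumeration `pairEnc`), the three-edge `staple` under a floor edge, the pairs `EH` of
  vertices of `ℍ`, the kissing weight `hsel`, and the densities `nu n = ν_n` (n-tall footed clusters per
  floor site), `eD n = e_n` (exact height `n`, verbatim the integral of the stub) and `kap n = κ_n` (kissing
  density), all under `P = P_{p_c(ℤ³)}` (`Negative.μ`);
* `stub_census_floorMTP` — the **mass-transport principle on the floor lattice** `∂ℍ ≅ ℤ²` in its most
  elementary form (Lyons–Peres 2016, §8.2): for `f(ω, x, y) ≥ 0` measurable in `ω` and invariant under the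
  diagonal action of the HORIZONTAL translations of `ℤ³`, `E Σ_{y ∈ ∂ℍ} f(ω, 0, y) = E Σ_{x ∈ ∂ℍ} f(ω, x, 0)`;
* root invariance and measurability of the objects; the selector selects exactly one element of a non-empty
  set.

Sources: R. Lyons – Y. Peres, *Probability on Trees and Networks* (2016), §8.2 (mass transport); the
objects extend those of `Literature/Probability/Percolation/HalfSpacePinnedPairs.lean`.
-/

noncomputable section

namespace Summit.CriticalPhenomena.PercolationContinuityZ3.Theorems.BoundaryTwoArmDecay

open MeasureTheory Filter Topology
open Literature.Probability.Percolation Literature.Probability.LatticeModels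
open scoped ENNReal

namespace StubCensus

/-! ## Objects: clusters in a region, slices, tallness -/

/-- `C_R(a)`: the vertices joined to `a` by an open path inside the region `R`. -/
def cl (R : Set (Site 3)) (a : Site 3) (ω : BondConfig (Site 3)) : Set (Site 3) :=
  {u | ω ∈ openConnIn R a u}

/-- `|C_R(a) ∩ {x₀ = l}|`, the size of the level-`l` slice of `C_R(a)` (in `ℕ∞`). -/
def fl (R : Set (Site 3)) (l : ℤ) (a : Site 3) (ω : BondConfig (Site 3)) : ℕ∞ :=
  (cl R a ω ∩ {u | u 0 = l}).encard

/-- The event "`C_R(a)` is `n`-TALL": the `R`-cluster of `a` meets level `n`. -/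
def tall (R : Set (Site 3)) (n : ℕ) (a : Site 3) : Set (BondConfig (Site 3)) :=
  {ω | ∃ y : Site 3, (n : ℤ) ≤ y 0 ∧ ω ∈ openConnIn R a y}

/-- The lowered half-space `ℍ₋₁ = {-1 ≤ x₀}`. -/
def Hm : Set (Site 3) := {x | -1 ≤ x 0}

/-- The vertical unit vector `e₀ = (1, 0, 0)`. -/
def e₀ : Site 3 := Pi.single 0 1

/-- Partner-kiss edges of `C_ℍ(a)` at height `n`: ordered floor edges `(q₁, q₂)` with `q₁ ∈ C_ℍ(a)`,
`q₂ ∉ C_ℍ(a)` and `C_ℍ(q₂)` `n`-tall. For `a = 0` this is verbatim the set of the stub. -/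
def PK (n : ℕ) (a : Site 3) (ω : BondConfig (Site 3)) : Set (Site 3 × Site 3) :=
  {q | q.1 0 = 0 ∧ q.2 0 = 0 ∧ (zdGraph 3).Adj q.1 q.2 ∧ ω ∈ openConnIn (halfSpace 3) a q.1 ∧
    ω ∉ openConnIn (halfSpace 3) a q.2 ∧ ω ∈ tall (halfSpace 3) n q.2}

/-- The sub-cluster functional `J`: sum over the floor points `γ` of `C_{ℍ₋₁}(a)` whose `ℍ`-cluster is
`n`-tall of `1/|C_ℍ(γ) ∩ ∂ℍ|` (it counts the `n`-tall `ℍ`-clusters inside `C_{ℍ₋₁}(a)`). -/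
def J (n : ℕ) (a : Site 3) (ω : BondConfig (Site 3)) : ℝ≥0∞ :=
  ∑' γ : Site 3, {γ : Site 3 | γ 0 = 0 ∧ γ ∈ cl Hm a ω ∧ ω ∈ tall (halfSpace 3) n γ}.indicator
    (fun γ => (((fl (halfSpace 3) 0 γ ω : ℕ∞) : ℝ≥0∞))⁻¹) γ

/-! ### Unfolding -/

/-- `ℍ = {0 ≤ x₀}`. -/
theorem halfSpace_eq : halfSpace 3 = {x : Site 3 | 0 ≤ x 0} := rfl

/-- `C_ℍ(0)` is the half-space cluster `U`. -/
theorem cl_zero_eq (ω : BondConfig (Site 3)) : cl (halfSpace 3) 0 ω = halfSpaceCluster ω := rfl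

/-- `|C_ℍ(0) ∩ ∂ℍ|` is the footprint. -/
theorem fl_zero_eq (ω : BondConfig (Site 3)) : fl (halfSpace 3) 0 0 ω = halfSpaceFootprint ω := rfl

/-- Membership in `cl`. -/
@[simp] theorem mem_cl {R : Set (Site 3)} {a u : Site 3} {ω : BondConfig (Site 3)} :
    u ∈ cl R a ω ↔ ω ∈ openConnIn R a u := Iff.rfl

/-- Membership in `tall`. -/
@[simp] theorem mem_tall {R : Set (Site 3)} {n : ℕ} {a : Site 3} {ω : BondConfig (Site 3)} :
    ω ∈ tall R n a ↔ ∃ y : Site 3, (n : ℤ) ≤ y 0 ∧ ω ∈ openConnIn R a y := Iff.rfl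

/-! ## The transport functions, the selector, the staple, the densities -/

/-- The TWO-ANCHOR transport function between floor sites `a` and `b`: mass flows from the `ℍ`-cluster of
`a` (when `n`-tall) to the floor points `b - e₀` of the `ℍ₋₁`-cluster containing it, with weight
`1/(J · |C_ℍ(a) ∩ ∂ℍ| · |C_{ℍ₋₁}(a) ∩ ∂ℍ₋₁|)`. -/
def fTA (n : ℕ) (ω : BondConfig (Site 3)) (a b : Site 3) : ℝ≥0∞ :=
  {ω' : BondConfig (Site 3) | a 0 = 0 ∧ b 0 = 0 ∧ ω' ∈ tall (halfSpace 3) n a ∧ b - e₀ ∈ cl Hm a ω'}.indicator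
    (fun ω' => (J n a ω')⁻¹ * ((((fl (halfSpace 3) 0 a ω' : ℕ∞) : ℝ≥0∞))⁻¹ *
      (((fl Hm (-1) a ω' : ℕ∞) : ℝ≥0∞))⁻¹)) ω

/-- The partner count at the root `a`: on `{C_ℍ(a) n-tall, at most k partner-kiss edges}`, the number of
partner-kiss edges of `C_ℍ(a)` starting at `a`. -/
def psi (n k : ℕ) (a : Site 3) (ω : BondConfig (Site 3)) : ℝ≥0∞ :=
  {ω' : BondConfig (Site 3) | ω' ∈ tall (halfSpace 3) n a ∧ (PK n a ω').ncard ≤ k}.indicator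
    (fun ω' => (((Prod.mk a ⁻¹' PK n a ω').encard : ℕ∞) : ℝ≥0∞)) ω

/-- The ROOT transport function between floor sites `a` and `b`: mass `psi/|C_ℍ(a) ∩ ∂ℍ|` flows from `a`
to every floor point `b` of `C_ℍ(a)`. -/
def fRT (n k : ℕ) (ω : BondConfig (Site 3)) (a b : Site 3) : ℝ≥0∞ :=
  {ω' : BondConfig (Site 3) | a 0 = 0 ∧ b 0 = 0 ∧ b ∈ cl (halfSpace 3) a ω'}.indicator
    (fun ω' => psi n k a ω' * (((fl (halfSpace 3) 0 a ω' : ℕ∞) : ℝ≥0∞))⁻¹) ω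

/-- A fixed enumeration of the ordered pairs of sites. -/
def pairEnc : Site 3 × Site 3 → ℕ := (Countable.exists_injective_nat (Site 3 × Site 3)).choose

/-- The enumeration is injective. -/
theorem pairEnc_injective : Function.Injective pairEnc := (Countable.exists_injective_nat (Site 3 × Site 3)).choose_spec

/-- The SELECTED elements of a set of pairs (those of least enumeration index): at most one, and one as soon
as the set is non-empty. -/
def sel (s : Set (Site 3 × Site 3)) : Set (Site 3 × Site 3) := {g | g ∈ s ∧ ∀ g' ∈ s, pairEnc g ≤ pairEnc g'}

/-- The STAPLE under the floor edge `g = (q₁, q₂)`: the three edges `q₁ ~ q₁ - e₀ ~ q₂ - e₀ ~ q₂` through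
level `-1`. -/
def staple (g : Site 3 × Site 3) : Finset (Sym2 (Site 3)) :=
  {s(g.1, g.1 - e₀), s(g.1 - e₀, g.2 - e₀), s(g.2 - e₀, g.2)}

/-- The pairs of vertices of `ℍ`: every event about `ℍ`-clusters is determined by the states of these. -/
def EH : Set (Sym2 (Site 3)) := (withinGraph ⊤ (halfSpace 3)).edgeSet

/-- The kissing weight carried by a selected kiss edge `g`: `1/|U ∩ ∂ℍ|` on `{U n-tall, g selected in PK}`. -/
def hsel (n : ℕ) (g : Site 3 × Site 3) (ω : BondConfig (Site 3)) : ℝ≥0∞ :=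
  {ω' : BondConfig (Site 3) | ω' ∈ tall (halfSpace 3) n 0 ∧ g ∈ sel (PK n 0 ω')}.indicator
    (fun ω' => (((fl (halfSpace 3) 0 0 ω' : ℕ∞) : ℝ≥0∞))⁻¹) ω

open Negative (μ)

/-- `ν_n`: the density per floor site of `n`-tall footed `ℍ`-clusters, `E[1{U n-tall}/|U ∩ ∂ℍ|]`. -/
def nu (n : ℕ) : ℝ≥0∞ :=
  ∫⁻ ω, (tall (halfSpace 3) n 0).indicator (fun ω => (((fl (halfSpace 3) 0 0 ω : ℕ∞) : ℝ≥0∞))⁻¹) ω ∂μ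

/-- `e_n`: the density of footed `ℍ`-clusters of exact height `n` (verbatim the integral of the stub). -/
def eD (n : ℕ) : ℝ≥0∞ :=
  ∫⁻ ω, {ω | (∃ y : Site 3, (n : ℤ) ≤ y 0 ∧ ω ∈ openConnIn (halfSpace 3) 0 y) ∧
      ¬ (∃ y : Site 3, ((n + 1 : ℕ) : ℤ) ≤ y 0 ∧ ω ∈ openConnIn (halfSpace 3) 0 y)}.indicator
    (fun ω => (((halfSpaceFootprint ω : ℕ∞) : ENNReal))⁻¹) ω ∂(bondPercolation (zdGraph 3) (criticalProbI 3))

/-- `κ_n`: the kissing density, `E[1{U n-tall, U has a partner-kiss edge}/|U ∩ ∂ℍ|]`. -/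
def kap (n : ℕ) : ℝ≥0∞ :=
  ∫⁻ ω, {ω | ω ∈ tall (halfSpace 3) n 0 ∧ (PK n 0 ω).Nonempty}.indicator
    (fun ω => (((fl (halfSpace 3) 0 0 ω : ℕ∞) : ℝ≥0∞))⁻¹) ω ∂μ

open LowPoint (conn_symm conn_trans conn_refl conn_mono conn_iff_mem_cluster)

/-! ### Root invariance -/

/-- `ℍ ⊆ ℍ₋₁`. -/
theorem halfSpace_subset_Hm : halfSpace 3 ⊆ Hm := fun x (hx : 0 ≤ x 0) => by
  show -1 ≤ x 0
  omega

/-- `a ∈ C_R(a)` for `a ∈ R`. -/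
theorem self_mem_cl {R : Set (Site 3)} {a : Site 3} (ha : a ∈ R) (ω : BondConfig (Site 3)) :
    a ∈ cl R a ω := conn_refl ω ha

/-- `C_R(a) ⊆ R`. -/
theorem cl_subset {R : Set (Site 3)} (a : Site 3) (ω : BondConfig (Site 3)) : cl R a ω ⊆ R :=
  fun _ hu => hu.2.1

/-- **Root invariance**: a vertex of `C_R(a)` has the same `R`-cluster. -/
theorem cl_eq_of_mem {R : Set (Site 3)} {a b : Site 3} {ω : BondConfig (Site 3)} (hb : b ∈ cl R a ω) :
    cl R b ω = cl R a ω := by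
  ext u
  exact ⟨fun h => conn_trans hb h, fun h => conn_trans (conn_symm hb) h⟩

/-- Root invariance of tallness. -/
theorem tall_iff_of_mem {R : Set (Site 3)} {n : ℕ} {a b : Site 3} {ω : BondConfig (Site 3)}
    (hb : b ∈ cl R a ω) : ω ∈ tall R n b ↔ ω ∈ tall R n a := by
  constructor
  · rintro ⟨y, hy, h⟩; exact ⟨y, hy, conn_trans hb h⟩
  · rintro ⟨y, hy, h⟩; exact ⟨y, hy, conn_trans (conn_symm hb) h⟩

/-- Root invariance of the slice sizes. -/
theorem fl_eq_of_mem {R : Set (Site 3)} {l : ℤ} {a b : Site 3} {ω : BondConfig (Site 3)}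
    (hb : b ∈ cl R a ω) : fl R l b ω = fl R l a ω := by
  rw [fl, fl, cl_eq_of_mem hb]

/-- Root invariance of the partner-kiss edges. -/
theorem PK_eq_of_mem {n : ℕ} {a b : Site 3} {ω : BondConfig (Site 3)} (hb : b ∈ cl (halfSpace 3) a ω) :
    PK n b ω = PK n a ω := by
  ext q
  have h1 : ω ∈ openConnIn (halfSpace 3) b q.1 ↔ ω ∈ openConnIn (halfSpace 3) a q.1 := by
    rw [← mem_cl, ← mem_cl, cl_eq_of_mem hb]
  have h2 : ω ∈ openConnIn (halfSpace 3) b q.2 ↔ ω ∈ openConnIn (halfSpace 3) a q.2 := by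
    rw [← mem_cl, ← mem_cl, cl_eq_of_mem hb]
  simp only [PK, Set.mem_setOf_eq, h1, h2]

/-- Root invariance of `J` (it only depends on `C_{ℍ₋₁}(a)`). -/
theorem J_eq_of_mem {n : ℕ} {a b : Site 3} {ω : BondConfig (Site 3)} (hb : b ∈ cl Hm a ω) :
    J n b ω = J n a ω := by
  simp only [J, cl_eq_of_mem hb]

/-- Tallness is monotone in the level. -/
theorem tall_mono {R : Set (Site 3)} {m n : ℕ} {a : Site 3} {ω : BondConfig (Site 3)} (h : ω ∈ tall R n a)
    (hmn : m ≤ n) : ω ∈ tall R m a := by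
  obtain ⟨y, hy, hc⟩ := h
  exact ⟨y, le_trans (by exact_mod_cast hmn) hy, hc⟩

/-- One more open step inside `R` extends an open connection. -/
theorem conn_step {R : Set (Site 3)} {a b c : Site 3} {ω : BondConfig (Site 3)} (h : ω ∈ openConnIn R a b)
    (hbc : s(b, c) ∈ ω) (hne : b ≠ c) (hc : c ∈ R) : ω ∈ openConnIn R a c := by
  have haR : a ∈ R := h.1
  rw [conn_iff_mem_cluster haR] at h ⊢
  exact mem_openClusterIn_of_adj h ⟨(SimpleGraph.top_adj b c).2 hne, cl_subset a ω
    ((conn_iff_mem_cluster haR).2 h), hc⟩ hbc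

/-! ### Measurability -/

/-- `{ω | u ∈ C_R(a)}` is measurable. -/
theorem measurableSet_mem_cl (R : Set (Site 3)) (a u : Site 3) :
    MeasurableSet {ω : BondConfig (Site 3) | u ∈ cl R a ω} :=
  measurableSet_openConnIn_of_countable R a u

/-- `ω ↦ C_R(a)` is measurable. -/
theorem measurable_cl (R : Set (Site 3)) (a : Site 3) :
    Measurable fun ω : BondConfig (Site 3) => cl R a ω :=
  measurable_set_iff.2 fun u => measurableSet_setOf.1 (measurableSet_mem_cl R a u)

/-- `ω ↦ fl R l a ω` is measurable. -/
theorem measurable_fl (R : Set (Site 3)) (l : ℤ) (a : Site 3) :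
    Measurable fun ω : BondConfig (Site 3) => fl R l a ω := by
  refine measurable_encard.comp (measurable_set_iff.2 fun u => ?_)
  exact (measurable_set_iff.1 (measurable_cl R a) u).and measurable_const

/-- `ω ↦ (fl R l a ω : ℝ≥0∞)⁻¹` is measurable. -/
theorem measurable_fl_inv (R : Set (Site 3)) (l : ℤ) (a : Site 3) :
    Measurable fun ω : BondConfig (Site 3) => (((fl R l a ω : ℕ∞) : ℝ≥0∞))⁻¹ :=
  ((Measurable.of_discrete (f := fun n : ℕ∞ => (n : ℝ≥0∞))).comp (measurable_fl R l a)).inv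

/-- The tallness event is measurable. -/
theorem measurableSet_tall (R : Set (Site 3)) (n : ℕ) (a : Site 3) : MeasurableSet (tall R n a) := by
  have h : tall R n a = ⋃ y ∈ {y : Site 3 | (n : ℤ) ≤ y 0}, openConnIn R a y := by
    ext ω
    simp only [tall, Set.mem_setOf_eq, Set.mem_iUnion, exists_prop]
  rw [h]
  exact MeasurableSet.biUnion (Set.to_countable _) fun y _ => measurableSet_openConnIn_of_countable R a y

/-- `{ω | q ∈ PK n a ω}` is measurable. -/
theorem measurableSet_mem_PK (n : ℕ) (a : Site 3) (q : Site 3 × Site 3) :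
    MeasurableSet {ω : BondConfig (Site 3) | q ∈ PK n a ω} := by
  have h : {ω : BondConfig (Site 3) | q ∈ PK n a ω} =
      {_ω | q.1 0 = 0 ∧ q.2 0 = 0 ∧ (zdGraph 3).Adj q.1 q.2} ∩ (openConnIn (halfSpace 3) a q.1 ∩
        ((openConnIn (halfSpace 3) a q.2)ᶜ ∩ tall (halfSpace 3) n q.2)) := by
    ext ω
    simp only [PK, Set.mem_setOf_eq, Set.mem_inter_iff, Set.mem_compl_iff]
    tauto
  rw [h]
  exact (MeasurableSet.const _).inter ((measurableSet_openConnIn_of_countable _ _ _).inter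
    ((measurableSet_openConnIn_of_countable _ _ _).compl.inter (measurableSet_tall _ _ _)))

/-- `ω ↦ PK n a ω` is measurable. -/
theorem measurable_PK (n : ℕ) (a : Site 3) : Measurable fun ω : BondConfig (Site 3) => PK n a ω :=
  measurable_set_iff.2 fun q => measurableSet_setOf.1 (measurableSet_mem_PK n a q)

/-- `ω ↦ J n a ω` is measurable. -/
theorem measurable_J (n : ℕ) (a : Site 3) : Measurable fun ω : BondConfig (Site 3) => J n a ω := by
  refine Measurable.tsum fun γ => ?_
  refine Measurable.ite ?_ (measurable_fl_inv _ _ _) measurable_const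
  refine (MeasurableSet.const _).inter ((measurableSet_mem_cl Hm a γ).inter (measurableSet_tall _ _ _))

/-! ### The selector -/

/-- Selected elements are elements. -/
theorem sel_subset (s : Set (Site 3 × Site 3)) : sel s ⊆ s := fun _ hg => hg.1

/-- At most one element is selected. -/
theorem sel_subsingleton (s : Set (Site 3 × Site 3)) : (sel s).Subsingleton := by
  rintro g ⟨hg, hmin⟩ g' ⟨hg', hmin'⟩
  exact pairEnc_injective (le_antisymm (hmin g' hg') (hmin' g hg))

/-- A non-empty set has a selected element. -/
theorem sel_nonempty {s : Set (Site 3 × Site 3)} (hs : s.Nonempty) : (sel s).Nonempty := by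
  classical
  have hex : ∃ m, ∃ g ∈ s, pairEnc g = m := by
    obtain ⟨g, hg⟩ := hs
    exact ⟨pairEnc g, g, hg, rfl⟩
  obtain ⟨g, hg, hgm⟩ := Nat.find_spec hex
  refine ⟨g, hg, fun g' hg' => ?_⟩
  rw [hgm]
  exact Nat.find_min' hex ⟨g', hg', rfl⟩

/-! ## The floor mass-transport principle (registered sub-goal `stub_census_floorMTP`) -/

end StubCensus

open LowPoint (lintegral_shift) in
/-- **Mass transport on the floor lattice** (registered sub-goal `stub_census_floorMTP` of `stub_census`).
If `f(ω, x, y) ≥ 0` is measurable in `ω` and diagonally invariant under horizontal shifts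
(`f(ω + v, x + v, y + v) = f(ω, x, y)` for `v₀ = 0`), then `E Σ_{y ∈ ∂ℍ} f(ω, 0, y) = E Σ_{x ∈ ∂ℍ} f(ω, x, 0)`
(Lyons–Peres 2016, §8.2, for the group `ℤ²` of horizontal translations: Tonelli, invariance of `P_p` under
each shift, Tonelli, and the reflection `x ↦ -x` of the floor). -/
theorem stub_census_floorMTP : ∀ (p : unitInterval) (f : BondConfig (Site 3) → Site 3 → Site 3 → ENNReal),
    (∀ x y : Site 3, Measurable fun ω => f ω x y) →
    (∀ (ω : BondConfig (Site 3)) (x y v : Site 3), v 0 = 0 →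
      f (BondConfig.relabel (sym2Equiv (Site.shift v)) ω) (x + v) (y + v) = f ω x y) →
    ∫⁻ ω, ∑' y, {y : Site 3 | y 0 = 0}.indicator (f ω 0) y ∂(bondPercolation (zdGraph 3) p) =
      ∫⁻ ω, ∑' x, {x : Site 3 | x 0 = 0}.indicator (fun x => f ω x 0) x ∂(bondPercolation (zdGraph 3) p) := by
  intro p f hf hcov
  have hmL : ∀ y, Measurable fun ω => {y : Site 3 | y 0 = 0}.indicator (f ω 0) y := by
    intro y
    by_cases hy : y 0 = 0
    · simp only [Set.indicator_of_mem (show y ∈ {y : Site 3 | y 0 = 0} from hy)]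
      exact hf 0 y
    · simp only [Set.indicator_of_notMem (show y ∉ {y : Site 3 | y 0 = 0} from hy)]
      exact measurable_const
  have hmR : ∀ x, Measurable fun ω => {x : Site 3 | x 0 = 0}.indicator (fun x => f ω x 0) x := by
    intro x
    by_cases hx : x 0 = 0
    · simp only [Set.indicator_of_mem (show x ∈ {x : Site 3 | x 0 = 0} from hx)]
      exact hf x 0
    · simp only [Set.indicator_of_notMem (show x ∉ {x : Site 3 | x 0 = 0} from hx)]
      exact measurable_const
  rw [lintegral_tsum fun y => (hmL y).aemeasurable, lintegral_tsum fun x => (hmR x).aemeasurable]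
  have hterm : ∀ y, ∫⁻ ω, {y : Site 3 | y 0 = 0}.indicator (f ω 0) y ∂(bondPercolation (zdGraph 3) p) =
      ∫⁻ ω, {x : Site 3 | x 0 = 0}.indicator (fun x => f ω x 0) (-y) ∂(bondPercolation (zdGraph 3) p) := by
    intro y
    by_cases hy : y 0 = 0
    · have hny : (-y) 0 = 0 := by rw [Pi.neg_apply, hy, neg_zero]
      simp only [Set.indicator_of_mem (show y ∈ {y : Site 3 | y 0 = 0} from hy),
        Set.indicator_of_mem (show -y ∈ {x : Site 3 | x 0 = 0} from hny)]
      have h1 : ∀ ω, f ω 0 y = f (BondConfig.relabel (sym2Equiv (Site.shift (-y))) ω) (-y) 0 := by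
        intro ω
        have := hcov ω 0 y (-y) hny
        rw [zero_add, add_neg_cancel] at this
        exact this.symm
      simp_rw [h1]
      exact lintegral_shift (-y) p (fun ω => f ω (-y) 0)
    · have hny : (-y) 0 ≠ 0 := by rwa [Pi.neg_apply, neg_ne_zero]
      simp only [Set.indicator_of_notMem (show y ∉ {y : Site 3 | y 0 = 0} from hy),
        Set.indicator_of_notMem (show -y ∉ {x : Site 3 | x 0 = 0} from hny)]
  rw [tsum_congr hterm]
  exact (Equiv.neg (Site 3)).tsum_eq
    (fun x => ∫⁻ ω, {x : Site 3 | x 0 = 0}.indicator (fun x => f ω x 0) x ∂(bondPercolation (zdGraph 3) p))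

end Summit.CriticalPhenomena.PercolationContinuityZ3.Theorems.BoundaryTwoArmDecay

end
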